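import Mathlib.Analysis.SpecialFunctions.Pow.Asymptotics
import Mathlib.Analysis.SpecialFunctions.Pow.Continuity
import Mathlib.Analysis.SpecialFunctions.Pow.Real
import Mathlib.Tactic.IntervalCases
import Mathlib.Algebra.Order.AbsoluteValue.Basic
import Mathlib.Data.Nat.Log
import Mathlib.Data.Nat.Choose.Sum

/-!
# Artin's lemma on the weak triangle inequality (proof-only; §1 of the Ostrowski engine behind [J-II½] Prop. 2.3.1)

Proof-only companion file of the abc-iut cell, branch E «type Joshi's construction, test vs S» (rung LADDER-ABC:A2.E;
seat abc-iut-E-t38, gen 4; lineage slot T-38 = [J-II½] arXiv:2305.10398v12 §2–§3, `Joshi/ArchimedeanUntiltsJoshi.lean`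
p432383). Joshi's valued fields «in the sense of [Bourbaki]» (§2.3 p.11 l.33–45) carry only the WEAK triangle inequality
`|x + y| ≤ A·max(|x|,|y|)`; to bring Mathlib's theory of `AbsoluteValue`s (triangle inequality) and its Ostrowski /
Gelfand–Mazur theorems to bear on Prop. 2.3.1 one needs E. Artin's classical lemma (*Algebraic numbers and algebraic
functions*, Ch. 1 §1, Thm. 3): **weak constant `2` ⟹ triangle inequality** (`add_le_add_of_weak_two`). It is proved
here in a two-parameter form (`add_le_add_of_sum_le`: a polynomial bound on finite sums and a linear bound on the
naturals suffice — the `n`-th power trick), which also yields the RENORMALISATION lemma `rpow_add_le_add`: if `v` is an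
absolute value and the power `v^c` is the identity on `ℕ`, then `v^c` is again an absolute value. Consumer:
`Joshi/ArchimedeanOstrowski.lean` (Ostrowski's theorem for archimedean absolute values) and
`Joshi/ArchimedeanOstrowskiProp231Holds.lean` (`prop231_holds : ATS2half.Prop231`).

FRAMING. Standard mathematics (folklore), no Joshi-specific content, no `def`, no hypothesis `Prop`, nothing of the
cell's frozen interface imported. No side is taken on [IUTchIII] Cor. 3.12 or on any author; typed ≠ proved. Standard
axioms only; sorry-free. bears_on: LADDER-ABC:A2.E
-/

set_option autoImplicit false

noncomputable section

open Filter Topology Finset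

namespace Summit.ABC.IUTFork.Joshi.ArchimedeanOstrowski

/-! ## 1. Artin's lemma: polynomial control of finite sums + linear control on `ℕ` ⟹ triangle inequality -/

section Artin

variable {K : Type*} [CommRing K]

/-- `C^{1/k} → 1` as `k → ∞` (`C > 0`). [folklore] -/
theorem tendsto_const_rpow_inv {C : ℝ} (hC : 0 < C) :
    Tendsto (fun k : ℕ => C ^ (k : ℝ)⁻¹) atTop (𝓝 1) :=
  ((continuous_iff_continuousAt.mpr fun _ => Real.continuousAt_const_rpow hC.ne').tendsto'
    0 1 (Real.rpow_zero C)).comp <| tendsto_inv_atTop_zero.comp tendsto_natCast_atTop_atTop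

/-- `(k+1)^{p/k} → 1` as `k → ∞`. [folklore] -/
theorem tendsto_succ_rpow_mul_inv (p : ℝ) :
    Tendsto (fun k : ℕ => ((k : ℝ) + 1) ^ (p * (k : ℝ)⁻¹)) atTop (𝓝 1) := by
  have h1 : Tendsto (fun k : ℕ => (k : ℝ) + 1) atTop atTop :=
    tendsto_natCast_atTop_atTop.atTop_add tendsto_const_nhds
  refine ((tendsto_rpow_div_mul_add p 1 (-1) zero_ne_one).comp h1).congr fun k => ?_
  simp only [Function.comp_def]
  congr 1
  ring

/-- **Artin's lemma (two-parameter form).** A multiplicative `f ≥ 0` with `f 0 = 0`, a polynomial bound on finite sums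
and a linear bound on the naturals satisfies the triangle inequality: from `f(x+y)^n = f((x+y)^n)`, the binomial
theorem and the two bounds, `f(x+y)^n ≤ C·D·(n+1)^p·(f x + f y)^n`; take `n`-th roots and let `n → ∞`. [folklore] -/
theorem add_le_add_of_sum_le (f : K →*₀ ℝ) (h0 : ∀ x, 0 ≤ f x) {C p D : ℝ} (hC : 0 < C) (hD : 0 < D)
    (hsum : ∀ (N : ℕ) (x : ℕ → K) (M : ℝ), 0 ≤ M → (∀ i < N, f (x i) ≤ M) →
      f (∑ i ∈ range N, x i) ≤ C * (N : ℝ) ^ p * M)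
    (hnat : ∀ m : ℕ, f m ≤ D * m) (x y : K) :
    f (x + y) ≤ f x + f y := by
  set S := f x + f y with hS
  have hS0 : 0 ≤ S := add_nonneg (h0 x) (h0 y)
  have hx0 : 0 ≤ f x := h0 x
  have hy0 : 0 ≤ f y := h0 y
  -- the key estimate `f(x+y)^n ≤ C·D·(n+1)^p·S^n`
  have key : ∀ n : ℕ, f (x + y) ^ n ≤ C * D * ((n : ℝ) + 1) ^ p * S ^ n := by
    intro n
    have hterm : ∀ k < n + 1, f (x ^ k * y ^ (n - k) * (n.choose k : K)) ≤ D * S ^ n := by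
      intro k hk
      rw [map_mul, map_mul, map_pow, map_pow]
      have h1 : f (n.choose k : K) ≤ D * (n.choose k : ℝ) := hnat _
      have h2 : (n.choose k : ℝ) * (f x ^ k * f y ^ (n - k)) ≤ S ^ n := by
        rw [hS, add_pow]
        have hnn : ∀ m ∈ range (n + 1), 0 ≤ f x ^ m * f y ^ (n - m) * (n.choose m : ℝ) :=
          fun m _ => by positivity
        calc (n.choose k : ℝ) * (f x ^ k * f y ^ (n - k))
            = f x ^ k * f y ^ (n - k) * (n.choose k : ℝ) := by ring
          _ ≤ ∑ m ∈ range (n + 1), f x ^ m * f y ^ (n - m) * (n.choose m : ℝ) :=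
              single_le_sum hnn (mem_range.mpr hk)
      calc f x ^ k * f y ^ (n - k) * f (n.choose k : K)
          ≤ f x ^ k * f y ^ (n - k) * (D * (n.choose k : ℝ)) :=
            mul_le_mul_of_nonneg_left h1 (by positivity)
        _ = D * ((n.choose k : ℝ) * (f x ^ k * f y ^ (n - k))) := by ring
        _ ≤ D * S ^ n := mul_le_mul_of_nonneg_left h2 hD.le
    calc f (x + y) ^ n = f ((x + y) ^ n) := (map_pow f _ _).symm
      _ ≤ C * ((n + 1 : ℕ) : ℝ) ^ p * (D * S ^ n) := by
          rw [add_pow]; exact hsum _ _ _ (by positivity) hterm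
      _ = C * D * ((n : ℝ) + 1) ^ p * S ^ n := by push_cast; ring
  -- `n`-th roots
  have root : ∀ n : ℕ, n ≠ 0 →
      f (x + y) ≤ (C * D) ^ (n : ℝ)⁻¹ * ((n : ℝ) + 1) ^ (p * (n : ℝ)⁻¹) * S := by
    intro n hn
    have hL : 0 ≤ C * D * ((n : ℝ) + 1) ^ p := by positivity
    calc f (x + y) = (f (x + y) ^ n) ^ (n : ℝ)⁻¹ := (Real.pow_rpow_inv_natCast (h0 _) hn).symm
      _ ≤ (C * D * ((n : ℝ) + 1) ^ p * S ^ n) ^ (n : ℝ)⁻¹ :=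
          Real.rpow_le_rpow (pow_nonneg (h0 _) n) (key n) (by positivity)
      _ = (C * D) ^ (n : ℝ)⁻¹ * ((n : ℝ) + 1) ^ (p * (n : ℝ)⁻¹) * S := by
          rw [Real.mul_rpow hL (pow_nonneg hS0 n), Real.mul_rpow (by positivity) (by positivity),
            Real.pow_rpow_inv_natCast hS0 hn, Real.rpow_mul (by positivity)]
  -- the limit `n → ∞`
  have lim : Tendsto (fun n : ℕ => (C * D) ^ (n : ℝ)⁻¹ * ((n : ℝ) + 1) ^ (p * (n : ℝ)⁻¹) * S)
      atTop (𝓝 S) := by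
    have := ((tendsto_const_rpow_inv (mul_pos hC hD)).mul (tendsto_succ_rpow_mul_inv p)).mul_const S
    simpa using this
  exact ge_of_tendsto lim (eventually_atTop.mpr ⟨1, fun n hn => root n (by omega)⟩)

/-- The binary-tree bound: the weak triangle inequality with constant `2` gives
`f (∑_{i<N} x_i) ≤ 2^r · M` whenever `N ≤ 2^r` and `f(x_i) ≤ M`. [folklore] -/
theorem sum_le_two_pow_mul (f : K →*₀ ℝ) (h2 : ∀ x y, f (x + y) ≤ 2 * max (f x) (f y)) :
    ∀ (r N : ℕ), N ≤ 2 ^ r → ∀ (x : ℕ → K) (M : ℝ), 0 ≤ M → (∀ i < N, f (x i) ≤ M) →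
      f (∑ i ∈ range N, x i) ≤ 2 ^ r * M := by
  intro r
  induction r with
  | zero =>
    intro N hN x M hM hx
    rw [pow_zero] at hN
    interval_cases N
    · simpa using hM
    · simpa using hx 0 zero_lt_one
  | succ r ih =>
    intro N hN x M hM hx
    obtain ⟨N₁, N₂, rfl, hN₁, hN₂⟩ : ∃ N₁ N₂, N = N₁ + N₂ ∧ N₁ ≤ 2 ^ r ∧ N₂ ≤ 2 ^ r := by
      set T := 2 ^ r with hT
      rw [pow_succ] at hN
      exact ⟨min N T, N - min N T, by omega, min_le_right _ _, by omega⟩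
    rw [sum_range_add]
    have hA := ih N₁ hN₁ x M hM (fun i hi => hx i (by omega))
    have hB := ih N₂ hN₂ (fun i => x (N₁ + i)) M hM (fun i hi => hx (N₁ + i) (by omega))
    calc f (∑ i ∈ range N₁, x i + ∑ i ∈ range N₂, x (N₁ + i))
        ≤ 2 * max (f (∑ i ∈ range N₁, x i)) (f (∑ i ∈ range N₂, x (N₁ + i))) := h2 _ _
      _ ≤ 2 * (2 ^ r * M) := mul_le_mul_of_nonneg_left (max_le hA hB) zero_le_two
      _ = 2 ^ (r + 1) * M := by ring

/-- Linear-in-`N` form of the tree bound: `f (∑_{i<N} x_i) ≤ 2·N·M`. [folklore] -/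
theorem sum_le_two_mul_card (f : K →*₀ ℝ) (h2 : ∀ x y, f (x + y) ≤ 2 * max (f x) (f y))
    (N : ℕ) (x : ℕ → K) (M : ℝ) (hM : 0 ≤ M) (hx : ∀ i < N, f (x i) ≤ M) :
    f (∑ i ∈ range N, x i) ≤ 2 * (N : ℝ) * M := by
  rcases Nat.eq_zero_or_pos N with rfl | hN
  · simp
  have hlt : N < 2 ^ (Nat.log 2 N + 1) := Nat.lt_pow_succ_log_self one_lt_two N
  have hle : 2 ^ Nat.log 2 N ≤ N := Nat.pow_log_le_self 2 hN.ne'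
  have hle' : (2 : ℝ) ^ Nat.log 2 N ≤ N := by exact_mod_cast hle
  calc f (∑ i ∈ range N, x i) ≤ 2 ^ (Nat.log 2 N + 1) * M :=
        sum_le_two_pow_mul f h2 _ N hlt.le x M hM hx
    _ = 2 * (2 : ℝ) ^ Nat.log 2 N * M := by ring
    _ ≤ 2 * (N : ℝ) * M := by gcongr

/-- Hence `f(m) ≤ 2·m` on the naturals. [folklore] -/
theorem natCast_le_two_mul (f : K →*₀ ℝ) (h2 : ∀ x y, f (x + y) ≤ 2 * max (f x) (f y)) (m : ℕ) :
    f m ≤ 2 * m := by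
  have h := sum_le_two_mul_card f h2 m (fun _ => (1 : K)) 1 zero_le_one (fun i _ => by simp)
  simpa using h

/-- **Artin's lemma.** A multiplicative `f ≥ 0`, `f 0 = 0`, `f 1 = 1`, with the weak triangle inequality
`f(x+y) ≤ 2·max(f x, f y)` satisfies the triangle inequality. [folklore] -/
theorem add_le_add_of_weak_two (f : K →*₀ ℝ) (h0 : ∀ x, 0 ≤ f x)
    (h2 : ∀ x y, f (x + y) ≤ 2 * max (f x) (f y)) (x y : K) : f (x + y) ≤ f x + f y :=
  add_le_add_of_sum_le f h0 (C := 2) (p := 1) (D := 2) two_pos two_pos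
    (fun N z M hM hz => by rw [Real.rpow_one]; exact sum_le_two_mul_card f h2 N z M hM hz)
    (natCast_le_two_mul f h2) x y

/-- **Renormalisation.** If `v` is an absolute value on `K` and the power `v^c` (`c > 0`) is the identity on the
naturals, then `v^c` still satisfies the triangle inequality (Artin's lemma with the polynomial sum bound
`v(∑_{i<N} x_i)^c ≤ N^c·max` inherited from `v` and the exact values on `ℕ`). [folklore] -/
theorem rpow_add_le_add [Nontrivial K] (v : AbsoluteValue K ℝ) {c : ℝ} (hc : 0 < c)
    (hnat : ∀ n : ℕ, v n ^ c = n) (x y : K) : v (x + y) ^ c ≤ v x ^ c + v y ^ c := by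
  let f : K →*₀ ℝ :=
    { toFun := fun z => v z ^ c
      map_zero' := by simp [hc.ne']
      map_one' := by show v 1 ^ c = 1; simp
      map_mul' := fun a b => by
        show v (a * b) ^ c = v a ^ c * v b ^ c
        rw [map_mul, Real.mul_rpow (v.nonneg a) (v.nonneg b)] }
  have hf : ∀ z, f z = v z ^ c := fun _ => rfl
  have h0 : ∀ z, 0 ≤ f z := fun z => Real.rpow_nonneg (v.nonneg z) c
  have key := add_le_add_of_sum_le f h0 (C := 1) (p := c) (D := 1) one_pos one_pos ?_ ?_ x y
  · simpa only [hf] using key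
  · intro N z M hM hz
    have hz' : ∀ i ∈ range N, v (z i) ≤ M ^ c⁻¹ := fun i hi =>
      (Real.le_rpow_inv_iff_of_pos (v.nonneg _) hM hc).mpr (hz i (mem_range.mp hi))
    have h1 : v (∑ i ∈ range N, z i) ≤ (N : ℝ) * M ^ c⁻¹ :=
      calc v (∑ i ∈ range N, z i) ≤ ∑ i ∈ range N, v (z i) := v.sum_le _ _
        _ ≤ ∑ _i ∈ range N, M ^ c⁻¹ := sum_le_sum hz'
        _ = (N : ℝ) * M ^ c⁻¹ := by simp
    calc f (∑ i ∈ range N, z i) = v (∑ i ∈ range N, z i) ^ c := rfl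
      _ ≤ ((N : ℝ) * M ^ c⁻¹) ^ c := Real.rpow_le_rpow (v.nonneg _) h1 hc.le
      _ = 1 * (N : ℝ) ^ c * M := by
          rw [Real.mul_rpow (Nat.cast_nonneg N) (Real.rpow_nonneg hM _), Real.rpow_inv_rpow hM hc.ne', one_mul]
  · intro m
    rw [hf, hnat, one_mul]

end Artin

end Summit.ABC.IUTFork.Joshi.ArchimedeanOstrowski
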